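import Summits.BirchSwinnertonDyer.BirchSwinnertonDyer.Theses.QuadraticBranchSignedControl
import Summits.BirchSwinnertonDyer.BirchSwinnertonDyer.Theorems.QuadraticBranchSignedControlPlusMainConjectureBranchCMRankZero
import Summits.BirchSwinnertonDyer.BirchSwinnertonDyer.Theorems.QuadraticBranchSignedControlPlusEtaCMRowsUpToMu
import Summits.BirchSwinnertonDyer.BirchSwinnertonDyer.Theorems.QuadraticBranchSignedControlEtaTransportPlus
import Summits.BirchSwinnertonDyer.BirchSwinnertonDyer.Theorems.QuadraticBranchSignedControlTwistPartnerModel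
import Literature.NumberTheory.EllipticCurves.ZywinaCMImageProofs
import HarnessLib

/-!
# Route `QuadraticBranchSignedControl` (rung K8, cell `bsd-potss`), item stmt-BirchSwinnertonDyer-19114
# `PlusMainConjectureBranch`: its REGISTERED BC5 rung stub `stub_plusMC_CM_rung` (skeleton e1351564,
# plan g8 — the CM rows of (C1_η) in the ITEM'S OWN `F`-form currency) PINNED BY NAME to (i) crux
# 19606's registered stub `stub_etaMC_cm` and (ii) ONE displayed `μ`-statement; per-pair currency
# bridge `F`-form ⟺ `η`-form (seat `bsd-potss-k8q-c2` g5)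

WHAT. Item 19114 carries three registered stubs (skeleton `e1351564`, plan g8): the branch-field split
`stub_plusMC_real` / `stub_plusMC_imaginary` (no bite: the seam of the crux is ⊇/⊆, FIND-19114) and the
BC5 rung `Sig.stub_plusMC_CM_rung := ∀ V p, 5 ≤ p → V.HasCM → good → a_p(V) = 0 →
QuadraticBranchPlusMainConjectureAt V p` (the CM rows, `F`-form; never addressed by name so far). This
file pins that rung text:
* §1 PER-PAIR CURRENCY BRIDGE. `QuadraticBranchPlusMainConjectureAt V p` (`F`-form: full signed dual
  data over `ℚ_∞` and over `F_∞`, `F = ℚ(√p*)`) ⟹ `QuadraticBranchPlusEtaMainConjectureAt V p`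
  (Kobayashi's even main conjecture at `η` VERBATIM on `X⁺(V/K_∞)^η`) for `p ≥ 5`, UNCONDITIONALLY
  (k8q-c3's `etaTransportPlus`, both frames proved); ⟸ granted Kobayashi's Thm. 1.2 (named fact `h12`)
  through the route's PROVED ∀-form descent frame `etaDescentFrame_proof` (item 19611) and seat g0's
  seam at `K₀ = ℚ(ζ_p)`. (The route-level iff `plusMainConjectureBranch_iff_forall_etaMainConjectureAt`
  of k8eta-c1 is the ∀-closure; the per-pair form is what row-wise work consumes.)
* §2 RUNG = 19606's CM STUB. `Sig.stub_plusMC_CM_rung` (19114) ⟹ the text of `Sig.stub_etaMC_cm`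
  (19606, skeleton v3 `bd0e0f112d94`) UNCONDITIONALLY; ⟸ granted `h12` (the `¬ onto` binder of the
  19606 stub is idle on CM rows: `not_hasSurjectiveModNGaloisRep_of_hasCM`, Zywina 2015 / Serre 1972).
* §3 RUNG = ONE `μ`-STATEMENT. Granted `h12`, `h26` (Burungale–Tian 2026 Thm. 2.6 ∘ Kobayashi) and
  `h22` (Kobayashi Thm. 2.2 at `η`): `Sig.stub_plusMC_CM_rung` ⟺ «on every CM Gss2 row and every
  `η`-datum, `μ(X⁺(V/K_∞)^η) = μ(Λ/(L_p⁺(V, η, X)))`» (seat g3's `μ`-criterion moved to `F`-currency).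
* §4 THE RUNG'S RESIDUAL IS OFF RANK ZERO. Granted the eight named facts of seat g4's rank-zero road
  (`h12 h26 hPT hmod hGZK h22 hKO hS28`), `Sig.stub_plusMC_CM_rung` ⟸ the `μ`-equality on those CM rows
  ONLY whose globally minimal `p*`-partner `W` (`C • W^{(p*)} = V`; it EXISTS for every `V`:
  `TwistPartner.exists_isGloballyMinimal_pStarPartner`, this seat) has `L(W,1) = 0` — the rank-zero
  CM rows are settled from print (g3/g4), and the `V`-side rung is split `W`-side by the new partner
  lemma.
So on the record: the BC5 rung of 19114 is, by name, «19606's CM stub» and «the `μ`-part of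
Burungale–Tian on the CM rows with `L(W,1) = 0`» — on its analytic-rank-one rows `BSD_p`-complete
modulo 19116 (g4, `…PlusEtaCMRankOneOfBT26`), on rows with `r_an(W) ≥ 2` outside the route's use.

HONEST FRAMING (cell `bsd-potss`, run/shared/lean/pub/bsd-potss/; FULL-BSD rank ≤ 1 programme, tranche
1b, HUMAN RULING D-0036/D-0074): THEOREMS ONLY — no definition, no new named fact, no `sorry`, axioms
standard. §1 ⟹ and §2 ⟹ are unconditional; everything else is CONDITIONAL on named Literature facts in
hypothesis position (Kobayashi 2003 Thm. 1.2 / Thm. 2.2 at `η`, Burungale–Tian 2026 Thm. 2.6,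
Poitou–Tate, modularity, GZK, Kitajima–Otsuki 1.3 at `η`, Burungale–Flach 2024 — none proved in the
tree) and, where displayed, on the `μ`-equality (OPEN: Burungale–Tian Rem. 2.7; Pollack–Rubin p. 448 is
a remark). The stub `stub_plusMC_CM_rung` is NOT proved by name; item 19114 stays OPEN (support; open
problem class-wide on its non-CM rows = 19601 / 19606 non-CM); nothing is booked; no label / mark /
count moves; BSD is not proved for any curve by this («bears on rung K8 of BirchSwinnertonDyer, never
summit credit»). `--supports stmt-BirchSwinnertonDyer-19114`.

References: [Kobayashi2003] Thm. 1.2 (p. 2), Thm. 2.2 (p. 5), §3 (p. 5), §4 Even main conjecture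
(p. 8); [BurungaleTian2026] Thm. 2.6 and Rem. 2.7 (p. 5); [PollackRubin2004] Theorem and remark p. 448;
[Zywina2015] Prop. 1.14 / 1.16; [Serre1972] §4.5; [BurungaleFlach2024] Thm. 1.1, Cor. 2;
[KitajimaOtsuki2018] Main Thm. 1.3; [GreenbergLNM1716] §3; [SilvermanAEC2009] X.5 Cor. 5.4, VIII.8
Cor. 8.3.
-/

set_option autoImplicit false
set_option linter.dupNamespace false

noncomputable section

open scoped Classical

open CongruenceSubgroup Field WeierstrassCurve
open Literature.NumberTheory.EllipticCurves
open Literature.NumberTheory.EllipticCurves.ModularForms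
open Literature.NumberTheory.GaloisRepresentations
open Literature.NumberTheory.GaloisCohomology
open Literature.NumberTheory.EllipticCurves.IwasawaAlgebra
open Literature.NumberTheory.EllipticCurves.IwasawaDual
open ZpExtension
open Summit.BirchSwinnertonDyer.Rank1Residual.Additive
open Summit.BirchSwinnertonDyer.Rank1Residual.Additive.SignedTwist
open Summit.BirchSwinnertonDyer.BirchSwinnertonDyer.Theses.QuadraticBranchSignedControl

namespace Summit.BirchSwinnertonDyer.BirchSwinnertonDyer.Theorems

namespace PlusMCBranchCMRung

/-! ## §1 Per-pair currency bridge: the `F`-form node versus the `η`-form node at `(V, p)` -/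

section PerPair

variable {V : WeierstrassCurve ℚ} [V.IsElliptic] [V.IsGloballyMinimal] {p : ℕ} [hp : Fact p.Prime]

/-- **`F`-form ⟹ `η`-form at a pair, UNCONDITIONALLY** (`p ≥ 5`): if the `F`-form (C1_η)
`QuadraticBranchPlusMainConjectureAt V p` holds then Kobayashi's even main conjecture at `η` holds
VERBATIM on every `η`-datum of `V` at `p` (`QuadraticBranchPlusEtaMainConjectureAt V p`) — k8q-c3's
`etaTransportPlus` (the (MC⁺_η) transport with both descent frames PROVED) read per pair. No named fact.
[cite: Kobayashi2003, §4 Even main conjecture (p. 8), §3 (p. 5)] -/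
theorem plusEtaMainConjectureAt_of_plusMainConjectureAt (hp5 : 5 ≤ p)
    (h : QuadraticBranchPlusMainConjectureAt V p) : QuadraticBranchPlusEtaMainConjectureAt V p := by
  intro K₀ _ _ _ _ ηq hηK hη1 N _ f hp2 hgood hap hf ϖ hϖ Lη hL κ γ hκ hγ hγK hγc D
  exact etaTransportPlus p hp5 K₀ ηq hηK hη1 V hp2 hgood hap h hf ϖ hϖ Lη hL κ γ hκ hγ hγK hγc D

/-- **`η`-form ⟹ `F`-form at a pair, granted Kobayashi's Thm. 1.2** (`p ≥ 5`, `V` good at `p`,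
`a_p(V) = 0`): the route's PROVED ∀-form descent frame `etaDescentFrame_proof` (item 19611) + seat g0's
per-pair seam `quadraticBranchPlusMainConjectureAt_of_etaPlusMainConjecture_of_decomposition` at
`K₀ = ℚ(ζ_p)` with the sign character of `√p*` (`exists_theta_eta_cyclotomicField`) — the composition
seat g4 inlined twice, now a citable per-pair lemma. CONDITIONAL on `h12`; nothing booked.
[cite: Kobayashi2003, Thm. 1.2 (p. 2), §4 Even main conjecture (p. 8)] [cite: GreenbergLNM1716, §3] -/
theorem plusMainConjectureAt_of_plusEtaMainConjectureAt
    (h12 : Kobayashi2003.thm12_signedSelmerDual_finite_torsion) (hp5 : 5 ≤ p)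
    (hgood : V.HasGoodReductionAtPrime p) (hap : V.frobeniusTrace p = 0)
    (hη : QuadraticBranchPlusEtaMainConjectureAt V p) : QuadraticBranchPlusMainConjectureAt V p := by
  have hp2 : p ≠ 2 := by omega
  haveI : NeZero p := ⟨hp.out.ne_zero⟩
  haveI : IsCyclotomicExtension {p} ℚ (CyclotomicField p ℚ) :=
    CyclotomicField.isCyclotomicExtension p ℚ
  haveI : (galRange (K := ℚ) (CyclotomicField p ℚ)).Normal := normal_galRange_cyclotomic p _
  obtain ⟨θ, ηq, -, -, -, hηK, hη1⟩ := exists_theta_eta_cyclotomicField p hp2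
  have hfr := etaDescentFrame_proof
  unfold Theses.QuadraticBranchSignedControl.EtaDescentFrame at hfr
  exact quadraticBranchPlusMainConjectureAt_of_etaPlusMainConjecture_of_decomposition h12
    (CyclotomicField p ℚ) ηq
    (fun κ γ hκ hγ hγK hγc F _ _ V' _ κF γF hF hθ hC' hκF hγF hζ =>
      hfr p hp5 (CyclotomicField p ℚ) ηq hηK hη1 V hgood hap κ γ hκ hγ hγK hγc F V' κF γF hF hθ hC' hκF
        hγF hζ)
    (fun hp2' hgood' hap' hf ϖ hϖ Lη hL κ γ hκ hγ hγK hγc D =>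
      hη (CyclotomicField p ℚ) ηq hηK hη1 hp2' hgood' hap' hf ϖ hϖ Lη hL κ γ hκ hγ hγK hγc D)

/-- **The two currencies agree at every pair of the items' range** (`p ≥ 5`, good, `a_p = 0`),
granted Thm. 1.2: `QuadraticBranchPlusMainConjectureAt V p ↔ QuadraticBranchPlusEtaMainConjectureAt V p`.
CONDITIONAL on `h12` (only for ⟸); nothing booked. [cite: Kobayashi2003, Thm. 1.2 (p. 2), §4 (p. 8)] -/
theorem plusMainConjectureAt_iff_plusEtaMainConjectureAt
    (h12 : Kobayashi2003.thm12_signedSelmerDual_finite_torsion) (hp5 : 5 ≤ p)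
    (hgood : V.HasGoodReductionAtPrime p) (hap : V.frobeniusTrace p = 0) :
    QuadraticBranchPlusMainConjectureAt V p ↔ QuadraticBranchPlusEtaMainConjectureAt V p :=
  ⟨plusEtaMainConjectureAt_of_plusMainConjectureAt hp5,
    plusMainConjectureAt_of_plusEtaMainConjectureAt h12 hp5 hgood hap⟩

omit [V.IsGloballyMinimal] in
/-- On a CM curve the `p`-adic tower is never onto (`p` odd): already `ρ̄_{V,p}` is not surjective
(Zywina 2015 Prop. 1.14/1.16, Serre 1972 §4.5; tree theorem `not_hasSurjectiveModNGaloisRep_of_hasCM`)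
— the `¬ onto` binder of 19606's stubs is idle on CM rows. [cite: Zywina2015, Prop. 1.14 and Prop. 1.16]
[cite: Serre1972, §4.5] -/
theorem not_forall_hasSurjectiveModNGaloisRep_pow_of_hasCM (hCM : V.HasCM) (hp2 : p ≠ 2) :
    ¬ (∀ m : ℕ, V.HasSurjectiveModNGaloisRep (p ^ m : ℕ)) := fun h =>
  V.not_hasSurjectiveModNGaloisRep_of_hasCM hCM hp.out hp2 (by simpa using h 1)

end PerPair

/-! ## §2 The rung stub of 19114 IS the CM stub of 19606 -/

/-- **`Sig.stub_plusMC_CM_rung` (19114) ⟹ `Sig.stub_etaMC_cm` (19606), UNCONDITIONALLY** — both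
texts verbatim (the registered abbreviations live in the non-importable skeleton files
`K8_PlusMainConjectureBranch_birth.lean` e1351564 / `PlusEtaMainConjectureNonsurj_birth_v3.lean`
bd0e0f112d94): the `F`-form (C1_η) on the CM rows gives Kobayashi's even main conjecture at `η` verbatim
on the CM rows (§1 ⟹). No named fact; neither stub is proved.
[cite: Kobayashi2003, §4 Even main conjecture (p. 8)] [cite: PollackRubin2004, Theorem and remark p. 448] -/
theorem etaMC_cm_of_plusMC_CM_rung
    (hrung : ∀ (V : WeierstrassCurve ℚ) [V.IsElliptic] [V.IsGloballyMinimal] (p : ℕ) [Fact p.Prime],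
      5 ≤ p → V.HasCM → V.HasGoodReductionAtPrime p → V.frobeniusTrace p = 0 →
        QuadraticBranchPlusMainConjectureAt V p) :
    ∀ (V : WeierstrassCurve ℚ) [V.IsElliptic] [V.IsGloballyMinimal] (p : ℕ) [Fact p.Prime],
      5 ≤ p → V.HasGoodReductionAtPrime p → V.frobeniusTrace p = 0 →
      ¬ (∀ m : ℕ, V.HasSurjectiveModNGaloisRep (p ^ m : ℕ)) → V.HasCM →
        QuadraticBranchPlusEtaMainConjectureAt V p := by
  intro V _ _ p _ hp5 hgood hap _ hCM
  exact plusEtaMainConjectureAt_of_plusMainConjectureAt hp5 (hrung V p hp5 hCM hgood hap)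

/-- **`Sig.stub_etaMC_cm` (19606) ⟹ `Sig.stub_plusMC_CM_rung` (19114), granted Kobayashi's Thm. 1.2**
(texts verbatim): on a CM row the `¬ onto` binder is discharged (`not_forall_hasSurjectiveModNGaloisRep_pow_of_hasCM`)
and the `η`-form is moved to the `F`-form by §1 ⟸ (proved frame + g0's seam). CONDITIONAL on `h12`;
neither stub is proved. [cite: Kobayashi2003, Thm. 1.2 (p. 2), §4 (p. 8)] [cite: Zywina2015, Prop. 1.14] -/
theorem plusMC_CM_rung_of_etaMC_cm (h12 : Kobayashi2003.thm12_signedSelmerDual_finite_torsion)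
    (hcm : ∀ (V : WeierstrassCurve ℚ) [V.IsElliptic] [V.IsGloballyMinimal] (p : ℕ) [Fact p.Prime],
      5 ≤ p → V.HasGoodReductionAtPrime p → V.frobeniusTrace p = 0 →
      ¬ (∀ m : ℕ, V.HasSurjectiveModNGaloisRep (p ^ m : ℕ)) → V.HasCM →
        QuadraticBranchPlusEtaMainConjectureAt V p) :
    ∀ (V : WeierstrassCurve ℚ) [V.IsElliptic] [V.IsGloballyMinimal] (p : ℕ) [Fact p.Prime],
      5 ≤ p → V.HasCM → V.HasGoodReductionAtPrime p → V.frobeniusTrace p = 0 →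
        QuadraticBranchPlusMainConjectureAt V p := by
  intro V _ _ p _ hp5 hCM hgood hap
  exact plusMainConjectureAt_of_plusEtaMainConjectureAt h12 hp5 hgood hap
    (hcm V p hp5 hgood hap (not_forall_hasSurjectiveModNGaloisRep_pow_of_hasCM hCM (by omega)) hCM)

/-- **The two registered CM stubs are ONE statement modulo Thm. 1.2**: `Sig.stub_plusMC_CM_rung`
(19114, `F`-form) ⟺ `Sig.stub_etaMC_cm` (19606, `η`-form), texts verbatim. CONDITIONAL on `h12` (for ⟸
only); neither stub is proved; nothing booked. [cite: Kobayashi2003, Thm. 1.2 (p. 2), §4 (p. 8)]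
[cite: PollackRubin2004, Theorem and remark p. 448] -/
theorem plusMC_CM_rung_iff_etaMC_cm (h12 : Kobayashi2003.thm12_signedSelmerDual_finite_torsion) :
    (∀ (V : WeierstrassCurve ℚ) [V.IsElliptic] [V.IsGloballyMinimal] (p : ℕ) [Fact p.Prime],
      5 ≤ p → V.HasCM → V.HasGoodReductionAtPrime p → V.frobeniusTrace p = 0 →
        QuadraticBranchPlusMainConjectureAt V p) ↔
    ∀ (V : WeierstrassCurve ℚ) [V.IsElliptic] [V.IsGloballyMinimal] (p : ℕ) [Fact p.Prime],
      5 ≤ p → V.HasGoodReductionAtPrime p → V.frobeniusTrace p = 0 →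
      ¬ (∀ m : ℕ, V.HasSurjectiveModNGaloisRep (p ^ m : ℕ)) → V.HasCM →
        QuadraticBranchPlusEtaMainConjectureAt V p :=
  ⟨etaMC_cm_of_plusMC_CM_rung, plusMC_CM_rung_of_etaMC_cm h12⟩

/-! ## §3 The rung stub is ONE displayed `μ`-statement (modulo Thm. 1.2, BT26 Thm. 2.6, Thm. 2.2 at `η`) -/

/-- **`Sig.stub_plusMC_CM_rung` ⟺ the `μ`-EQUALITY on the CM `η`-data.** Granted `h12` (Kobayashi
Thm. 1.2), `h26` (Burungale–Tian 2026 Thm. 2.6 ∘ Kobayashi §5/§7) and `h22` (Kobayashi Thm. 2.2 at `η`):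
the rung text (CM rows of item 19114, `F`-form) holds IF AND ONLY IF for every `p ≥ 5`, every CM `V`
good at `p` with `a_p(V) = 0`, on the binders of the `η`-node and for every `η`-datum `D` and every `Lη`
with the interpolation property of `L_p⁺(V, η, X)`, `μ(D.X) = μ(Λ/(Lη))` — seat g3's `μ`-criterion
(`EtaCMUpToMu.quadraticBranchPlusEtaMainConjectureAt_iff_muInvariant_eq_of_cm`) composed with §1. The
distinguished-polynomial part of the rung is print (BT26); its open content is EXACTLY this `μ`-part
(BT26 Rem. 2.7). CONDITIONAL; the stub is not proved; nothing booked.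
[cite: BurungaleTian2026, Thm. 2.6 and Rem. 2.7 (p. 5)] [cite: Kobayashi2003, Thm. 1.2 (p. 2), Thm. 2.2 (p. 5), §4 (p. 8)]
[cite: Washington1997, §13.2] -/
theorem plusMC_CM_rung_iff_muInvariant_eq
    (h12 : Kobayashi2003.thm12_signedSelmerDual_finite_torsion)
    (h26 : BurungaleTian2026.thm26_etaKatoSequences_charIdeal_upToP_of_cm)
    (h22 : Kobayashi2003.thm22_etaSignedSelmerDual_finite_torsion) :
    (∀ (V : WeierstrassCurve ℚ) [V.IsElliptic] [V.IsGloballyMinimal] (p : ℕ) [Fact p.Prime],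
      5 ≤ p → V.HasCM → V.HasGoodReductionAtPrime p → V.frobeniusTrace p = 0 →
        QuadraticBranchPlusMainConjectureAt V p) ↔
    ∀ (V : WeierstrassCurve ℚ) [V.IsElliptic] [V.IsGloballyMinimal] (p : ℕ) [Fact p.Prime],
      5 ≤ p → V.HasCM → V.HasGoodReductionAtPrime p → V.frobeniusTrace p = 0 →
      ∀ (K₀ : Type) [Field K₀] [NumberField K₀] [IsCyclotomicExtension {p} ℚ K₀]
          [(galRange (K := ℚ) K₀).Normal] (ηq : absoluteGaloisGroup ℚ →* ℤˣ),
          (∀ σ ∈ galRange (K := ℚ) K₀, ηq σ = 1) → ηq ≠ 1 →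
        ∀ {N : ℕ} [NeZero N] {f : CuspForm (Gamma0 N) 2},
          p ≠ 2 → V.HasGoodReductionAtPrime p → V.frobeniusTrace p = 0 → IsNewformOf V f →
        ∀ (ϖ : ℚ), (if Even (p / 2) then (ϖ : ℝ) * V.realPeriodRat = plusPeriod f
            else (ϖ : ℝ) * V.imaginaryPeriodRat = minusPeriod f) →
        ∀ (Lη : IwasawaAlgebra p), IsQuadraticBranchPlusLFunction f p ϖ Lη →
        ∀ (κ : ZpExtension ℚ p) (γ : absoluteGaloisGroup ℚ),
          κ.IsCyclotomic → κ.IsTopGenerator γ → γ ∈ galRange (K := ℚ) K₀ → IsCyclotomicVariable p γ →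
        ∀ (D : EtaSignedSelmerDualData V κ K₀ ℚ_[p] ηq γ 1),
          muInvariant p D.X = muInvariant p (IwasawaAlgebra p ⧸ Ideal.span {Lη}) := by
  constructor
  · intro hrung V _ _ p _ hp5 hCM hgood hap
    exact (EtaCMUpToMu.quadraticBranchPlusEtaMainConjectureAt_iff_muInvariant_eq_of_cm h26 h22 hCM).mp
      (plusEtaMainConjectureAt_of_plusMainConjectureAt hp5 (hrung V p hp5 hCM hgood hap))
  · intro hμ V _ _ p _ hp5 hCM hgood hap
    exact plusMainConjectureAt_of_plusEtaMainConjectureAt h12 hp5 hgood hap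
      ((EtaCMUpToMu.quadraticBranchPlusEtaMainConjectureAt_iff_muInvariant_eq_of_cm h26 h22 hCM).mpr
        (hμ V p hp5 hCM hgood hap))

/-! ## §4 The rung's open content sits OFF analytic rank zero -/

/-- **`Sig.stub_plusMC_CM_rung` from named facts and the `μ`-equality on the `L(W,1) = 0` CM rows
ONLY.** Granted the eight named facts of the rank-zero road (`h12` Kobayashi Thm. 1.2, `h26` BT26 Thm.
2.6 ∘ Kobayashi, `hPT` Poitou–Tate, `hmod` modularity, `hGZK` Gross–Zagier–Kolyvagin, `h22` Kobayashi
Thm. 2.2 at `η`, `hKO` Kitajima–Otsuki 1.3 at `η`, `hS28` Burungale–Flach 2024) and the `μ`-equality on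
the `η`-data of those CM Gss2 twists `V` that are `C • W^{(p*)}` for SOME globally minimal `W` with
`L(W,1) = 0` (displayed, OPEN): the rung text for EVERY CM row. Proof: every `V` HAS a globally minimal
`p*`-partner `W` (`TwistPartner.exists_isGloballyMinimal_pStarPartner`, this seat); if `L(W,1) ≠ 0`, seat
g4's `PlusMCBranchCMRankZero.plusMainConjectureAt_of_namedFacts_of_hasCM_rankZero` (print only); else the
`μ`-hypothesis + §3's direction ⟸. CONDITIONAL; the stub is not proved; nothing booked.
[cite: BurungaleTian2026, Thm. 2.6 and Rem. 2.7 (p. 5)] [cite: BurungaleFlach2024, Thm. 1.1 and Cor. 2]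
[cite: Kobayashi2003, Thm. 1.2 (p. 2), Thm. 2.2 (p. 5), §4 (p. 8)] [cite: KitajimaOtsuki2018, Main Thm. 1.3]
[cite: SilvermanAEC2009, VIII.8 Cor. 8.3] -/
theorem plusMC_CM_rung_of_namedFacts_of_muInvariant_eq_of_L_one_eq_zero
    (h12 : Kobayashi2003.thm12_signedSelmerDual_finite_torsion)
    (h26 : BurungaleTian2026.thm26_etaKatoSequences_charIdeal_upToP_of_cm)
    (hPT : poitouTate_selmerStructure_duality_real ℚ) (hmod : hasEntireLFunction_rat)
    (hGZK : rank_eq_analyticRank_of_analyticRank_le_one)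
    (h22 : Kobayashi2003.thm22_etaSignedSelmerDual_finite_torsion)
    (hKO : KitajimaOtsuki2018.mainThm13_etaSignedSelmerDual_noFiniteSubmodule)
    (hS28 : bsdTriple_of_hasCM_of_L_one_ne_zero)
    (hμ : ∀ (V : WeierstrassCurve ℚ) [V.IsElliptic] [V.IsGloballyMinimal] (p : ℕ) [Fact p.Prime],
      5 ≤ p → V.HasCM → V.HasGoodReductionAtPrime p → V.frobeniusTrace p = 0 →
      ∀ (W : WeierstrassCurve ℚ) [W.IsElliptic] [W.IsGloballyMinimal] (C : VariableChange ℚ),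
        C • W.quadraticTwist ((-1) ^ (p / 2) * p) = V → W.entireLFunction 1 = 0 →
      ∀ (K₀ : Type) [Field K₀] [NumberField K₀] [IsCyclotomicExtension {p} ℚ K₀]
          [(galRange (K := ℚ) K₀).Normal] (ηq : absoluteGaloisGroup ℚ →* ℤˣ),
          (∀ σ ∈ galRange (K := ℚ) K₀, ηq σ = 1) → ηq ≠ 1 →
        ∀ {N : ℕ} [NeZero N] {f : CuspForm (Gamma0 N) 2},
          p ≠ 2 → V.HasGoodReductionAtPrime p → V.frobeniusTrace p = 0 → IsNewformOf V f →
        ∀ (ϖ : ℚ), (if Even (p / 2) then (ϖ : ℝ) * V.realPeriodRat = plusPeriod f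
            else (ϖ : ℝ) * V.imaginaryPeriodRat = minusPeriod f) →
        ∀ (Lη : IwasawaAlgebra p), IsQuadraticBranchPlusLFunction f p ϖ Lη →
        ∀ (κ : ZpExtension ℚ p) (γ : absoluteGaloisGroup ℚ),
          κ.IsCyclotomic → κ.IsTopGenerator γ → γ ∈ galRange (K := ℚ) K₀ → IsCyclotomicVariable p γ →
        ∀ (D : EtaSignedSelmerDualData V κ K₀ ℚ_[p] ηq γ 1),
          muInvariant p D.X = muInvariant p (IwasawaAlgebra p ⧸ Ideal.span {Lη})) :
    ∀ (V : WeierstrassCurve ℚ) [V.IsElliptic] [V.IsGloballyMinimal] (p : ℕ) [Fact p.Prime],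
      5 ≤ p → V.HasCM → V.HasGoodReductionAtPrime p → V.frobeniusTrace p = 0 →
        QuadraticBranchPlusMainConjectureAt V p := by
  intro V _ _ p _ hp5 hCM hgood hap
  obtain ⟨W, hWE, hWM, C, hCV⟩ := TwistPartner.exists_isGloballyMinimal_pStarPartner V p
  by_cases hLW : W.entireLFunction 1 = 0
  · exact plusMainConjectureAt_of_plusEtaMainConjectureAt h12 hp5 hgood hap
      ((EtaCMUpToMu.quadraticBranchPlusEtaMainConjectureAt_iff_muInvariant_eq_of_cm h26 h22 hCM).mpr
        (hμ V p hp5 hCM hgood hap W C hCV hLW))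
  · exact PlusMCBranchCMRankZero.plusMainConjectureAt_of_namedFacts_of_hasCM_rankZero h12 h26 hPT hmod
      hGZK h22 hKO hS28 W p V C hp5 hCV hgood hap hCM hLW

end PlusMCBranchCMRung

end Summit.BirchSwinnertonDyer.BirchSwinnertonDyer.Theorems

end
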